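import Literature.Topology.FourManifolds.HandleChartField
import Literature.Topology.FourManifolds.PrescribedUnitField
import Literature.Topology.FourManifolds.RegularIntervalBoundary
import Literature.Topology.FourManifolds.InteriorFieldFlow
import HarnessLib

/-!
# The vector field of the handle-extension step: Milnor's model at the critical point, unit
# speed on a slab, a prescribed germ on a band, zero near the boundary

Topic `Literature/Topology/FourManifolds` (fact seat
`provefact-Literature.Topology.FourManifolds.IsHandlebody.exists_isBoundaryGluing_sphere`, step F2b of
the Lickorish–Wallace DAG; field layer of the handle-extension step of the classification of
handlebodies).  Everything here is **proved**; no named facts.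

On a compact manifold with boundary `M` with a smooth function `f` (think: a handlebody stage
and its adapted Morse function), a critical point `p` with a Morse chart `φ` in Milnor's form
`f = f p + Q_k(φ̂ - φ̂ p)` on `φ.source`, levels `ℓ₀ < ℓ₁ ≤ ℓ₂ < ℓ₃` such that `p` is the only
critical point in `f⁻¹[ℓ₀, ℓ₃]`, and a germ of unit-speed field `ξ₂` near a closed set `K₂`
away from the chart ball, `exists_handleField` produces a smooth vector field `X` on `M` with

* `X = φ̂^* Ê_{k,r}` on the chart ball of radius `R₁` about `p` — so `φ` (restricted) is a
  **handle chart** for `(f, X)` (`HandleChartField.lean`): Milnor's `(-x⃗, y⃗)` in the core,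
  unit speed off the core (Milnor 1965, Def. 3.1 (2) and proof of Thm. 3.4, `ξ̂(f) ≡ 1`);
* `X(f) = 1` on `f⁻¹[ℓ₁, ℓ₂]` off the core ball (the partition-of-unity extension of
  `PrescribedUnitField.lean`, Milnor's Lemma 3.2 / Thm. 3.4);
* `X = ξ₂` on `K₂` (the band on which the field must be the pull-back of the field of the
  other manifold, so that the flows correspond there);
* `X = 0` off `f⁻¹(ℓ₀, ℓ₃)`, in particular near `∂M` when `ℓ₃ < f|∂M` — so `X` is an interior
  field (`Literature.Topology.FourManifolds.IsInteriorField`, `InteriorFieldFlow.lean`) and has a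
  global smooth flow (Lee 2012, Thm. 9.16; Milnor, proof of Lemma 4.6).

## References

* J. Milnor, *Lectures on the h-cobordism theorem* (1965), Def. 3.1, Lemma 3.2, proofs of
  Thm. 3.4 (PDF p. 13) and Lemma 4.6 (PDF p. 24). [MilnorHCobordism1965]
* J. M. Lee, *Introduction to Smooth Manifolds*, 2nd ed. (2012), Thm. 9.16. [LeeSmoothManifolds2013]
-/

open scoped Manifold ContDiff Topology
open Set Function Filter Metric

noncomputable section

namespace Literature.Topology.FourManifolds

universe u

variable {n : ℕ} {M : Type u} [TopologicalSpace M] [T2Space M] [CompactSpace M]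
  [ChartedSpace (EuclideanHalfSpace (n + 1)) M] [IsManifold (𝓡∂ (n + 1)) ∞ M]

/-- Local notation: `𝔼 m` is the model Euclidean space `EuclideanSpace ℝ (Fin m)`. -/
local notation "𝔼 " m:arg => EuclideanSpace ℝ (Fin m)

/-- **The field of the handle-extension step.**  Data: `f` smooth on the compact manifold with
boundary `M` with `f > ℓ₃` on `∂M`; a point `p` with a chart `φ` of the maximal atlas in
Milnor's form `f = f p + Q_k(φ̂ - φ̂ p)` on `φ.source`, the closed chart ball of radius `R`
about `φ̂ p` inside the chart target; radii `0 < r`, `2r < R₁ < R` with the ball of radius `R₁`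
inside the levels `[ℓ₁, ℓ₂]` (`ℓ₁ ≤ f p - R₁²`, `f p + R₁² ≤ ℓ₂`); no critical point other than
`p` in `f⁻¹[ℓ₀, ℓ₃]`; a closed `K₂ ⊆ U₂` (open, disjoint from the chart ball of radius `R`,
inside `f⁻¹[ℓ₁, ℓ₂]`) with a field `ξ₂` smooth on `U₂` with `ξ₂(f) = 1`.  Conclusion: a smooth
field `X` on `M`, an interior field (zero off `f⁻¹(ℓ₀, ℓ₃)`), with a handle chart at `p` of
index `k` and core radius `r` on the chart ball of radius `R₁` (same coordinates as `φ`),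
`X = ξ₂` on `K₂`, and `X(f) = 1` at every point of `f⁻¹[ℓ₁, ℓ₂]` not in the core ball
`{q ∈ φ.source | ‖φ̂ q - φ̂ p‖ < 2r}`.  Milnor 1965, Def. 3.1, Lemma 3.2, proofs of Thm. 3.4 and
Lemma 4.6. [cite: MilnorHCobordism1965, Def. 3.1, Lemma 3.2 and proof of Thm. 3.4 (PDF pp. 12–13)] -/
theorem exists_handleField {f : M → ℝ} (hf : ContMDiff (𝓡∂ (n + 1)) 𝓘(ℝ, ℝ) ∞ f)
    {ℓ₀ ℓ₁ ℓ₂ ℓ₃ : ℝ} (h01 : ℓ₀ < ℓ₁) (h23 : ℓ₂ < ℓ₃)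
    (hbd : ∀ x ∈ (𝓡∂ (n + 1)).boundary M, ℓ₃ < f x)
    {p : M} {φ : OpenPartialHomeomorph M (EuclideanHalfSpace (n + 1))}
    (hφ : φ ∈ IsManifold.maximalAtlas (𝓡∂ (n + 1)) ∞ M) (hpφ : p ∈ φ.source) {k : ℕ}
    (hfq : ∀ q ∈ φ.source, f q = f p +
      milnorQuadratic k (φ.extend (𝓡∂ (n + 1)) q - φ.extend (𝓡∂ (n + 1)) p))
    {r R₁ R : ℝ} (hr : 0 < r) (hrR₁ : 2 * r < R₁) (hR₁R : R₁ < R)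
    (hR : closedBall (φ.extend (𝓡∂ (n + 1)) p) R ⊆ (φ.extend (𝓡∂ (n + 1))).target)
    (hℓ₁ : ℓ₁ ≤ f p - R₁ ^ 2) (hℓ₂ : f p + R₁ ^ 2 ≤ ℓ₂)
    (hreg : ∀ x, f x ∈ Icc ℓ₀ ℓ₃ → x ≠ p → mfderiv (𝓡∂ (n + 1)) 𝓘(ℝ, ℝ) f x ≠ 0)
    {K₂ U₂ : Set M} (hK₂ : IsClosed K₂) (hU₂ : IsOpen U₂) (hKU₂ : K₂ ⊆ U₂)
    (hK₂ℓ : ∀ x ∈ K₂, f x ∈ Icc ℓ₁ ℓ₂)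
    (hdisj : Disjoint U₂ (φ.source ∩ φ.extend (𝓡∂ (n + 1)) ⁻¹' ball (φ.extend (𝓡∂ (n + 1)) p) R))
    {ξ₂ : Π x : M, TangentSpace (𝓡∂ (n + 1)) x}
    (hξ₂ : ContMDiffOn (𝓡∂ (n + 1)) (𝓡∂ (n + 1)).tangent ∞
      (fun x => (⟨x, ξ₂ x⟩ : TangentBundle (𝓡∂ (n + 1)) M)) U₂)
    (hξ₂f : ∀ x ∈ U₂, mlineDeriv (𝓡∂ (n + 1)) f x (ξ₂ x) = 1) :
    ∃ (X : Π x : M, TangentSpace (𝓡∂ (n + 1)) x) (D : HandleChart (𝓡∂ (n + 1)) f X p),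
      IsInteriorField (𝓡∂ (n + 1)) X ∧
      D.k = k ∧ D.r = r ∧ (∀ q, D.chart.extend (𝓡∂ (n + 1)) q = φ.extend (𝓡∂ (n + 1)) q) ∧
      D.chart.source = φ.source ∩ φ.extend (𝓡∂ (n + 1)) ⁻¹' ball (φ.extend (𝓡∂ (n + 1)) p) R₁ ∧
      (∀ x ∈ K₂, X x = ξ₂ x) ∧
      (∀ x, f x ∈ Icc ℓ₁ ℓ₂ →
        x ∉ φ.source ∩ φ.extend (𝓡∂ (n + 1)) ⁻¹' ball (φ.extend (𝓡∂ (n + 1)) p) (2 * r) →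
        mlineDeriv (𝓡∂ (n + 1)) f x (X x) = 1) ∧
      (∀ x, f x ∉ Ioo ℓ₀ ℓ₃ → X x = 0) ∧
      (∀ x, f x ∈ Icc ℓ₁ ℓ₂ → x ∈ φ.source →
        ‖φ.extend (𝓡∂ (n + 1)) x - φ.extend (𝓡∂ (n + 1)) p‖ < R₁ →
        X x = handlePullback (J := 𝓡∂ (n + 1)) φ p k hr x) := by
  classical
  set Φ := φ.extend (𝓡∂ (n + 1)) with hΦ
  set u₀ : 𝔼 (n + 1) := Φ p with hu₀
  have h12 : ℓ₁ ≤ ℓ₂ := by nlinarith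
  have hR₁ : 0 < R₁ := by linarith
  have hsrc : Φ.source = φ.source := φ.extend_source
  -- the sets
  set Uφ : Set M := φ.source ∩ Φ ⁻¹' ball u₀ R with hUφ
  set W : Set M := φ.source ∩ Φ ⁻¹' ball u₀ (2 * r) with hW
  set O : Set M := φ.source ∩ Φ ⁻¹' ball u₀ R₁ with hO
  have hopen : ∀ ρ : ℝ, IsOpen (φ.source ∩ Φ ⁻¹' ball u₀ ρ) := fun ρ => by
    have h := φ.continuousOn_extend (I := 𝓡∂ (n + 1))
    rw [hsrc] at h
    exact h.isOpen_inter_preimage φ.open_source isOpen_ball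
  have hUφo : IsOpen Uφ := hopen R
  have hWo : IsOpen W := hopen (2 * r)
  have hOo : IsOpen O := hopen R₁
  set Kφ : Set M := Φ.symm '' closedBall u₀ R₁ with hKφ
  have hKφc : IsCompact Kφ := (isCompact_closedBall u₀ R₁).image_of_continuousOn
    ((φ.continuousOn_extend_symm (I := 𝓡∂ (n + 1))).mono ((closedBall_subset_closedBall hR₁R.le).trans hR))
  have hKφ_sub : Kφ ⊆ Uφ := by
    rintro _ ⟨v, hv, rfl⟩
    have hvt : v ∈ Φ.target := hR (closedBall_subset_closedBall hR₁R.le hv)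
    refine ⟨by rw [← hsrc]; exact Φ.map_target hvt, ?_⟩
    show Φ (Φ.symm v) ∈ ball u₀ R
    rw [Φ.right_inv hvt]
    exact closedBall_subset_ball hR₁R hv
  have hO_sub : O ⊆ Kφ := by
    rintro x ⟨hx, hxb⟩
    refine ⟨Φ x, ball_subset_closedBall hxb, ?_⟩
    exact Φ.left_inv (by rw [hsrc]; exact hx)
  -- the local datum
  set ξ₀ : Π x : M, TangentSpace (𝓡∂ (n + 1)) x := fun x =>
    if x ∈ U₂ then ξ₂ x else handlePullback (J := 𝓡∂ (n + 1)) φ p k hr x with hξ₀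
  have hξ₀U₂ : ∀ x ∈ U₂, ξ₀ x = ξ₂ x := fun x hx => by simp [hξ₀, hx]
  have hξ₀φ : ∀ x ∈ Uφ, ξ₀ x = handlePullback (J := 𝓡∂ (n + 1)) φ p k hr x := fun x hx => by
    have : x ∉ U₂ := fun h => hdisj.le_bot ⟨h, hx⟩
    simp [hξ₀, this]
  -- the handle chart of the local field
  let D₀ : HandleChart (𝓡∂ (n + 1)) f (handlePullback (J := 𝓡∂ (n + 1)) φ p k hr) p :=
    HandleChart.ofEqOn φ hφ hpφ k hr hfq fun q _ => rfl
  have hD₀coord : ∀ q, D₀.coord q = Φ q - u₀ := fun q => rfl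
  have hξ₀_smooth : ContMDiffOn (𝓡∂ (n + 1)) (𝓡∂ (n + 1)).tangent ∞ (fun x => (⟨x, ξ₀ x⟩ : TangentBundle (𝓡∂ (n + 1)) M)) (U₂ ∪ Uφ) := by
    apply contMDiffOn_of_locally_contMDiffOn
    rintro x (hx | hx)
    · refine ⟨U₂, hU₂, hx, ?_⟩
      have : (U₂ ∪ Uφ) ∩ U₂ = U₂ := by rw [inter_eq_right]; exact subset_union_left
      rw [this]
      exact hξ₂.congr fun y hy => by simp only [hξ₀U₂ y hy]
    · refine ⟨Uφ, hUφo, hx, ?_⟩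
      have : (U₂ ∪ Uφ) ∩ Uφ = Uφ := by rw [inter_eq_right]; exact subset_union_right
      rw [this]
      exact ((contMDiffOn_handlePullback hφ p k hr).mono inter_subset_left).congr
        fun y hy => by simp only [hξ₀φ y hy]
  -- the constraint set
  set C : Set M := f ⁻¹' Icc ℓ₁ ℓ₂ \ W with hC
  have hCc : IsClosed C := (isClosed_Icc.preimage hf.continuous).sdiff hWo
  have hpW : p ∈ W := ⟨hpφ, by simp [hu₀, hr]⟩
  have hregC : ∀ x ∈ C, mfderiv (𝓡∂ (n + 1)) 𝓘(ℝ, ℝ) f x ≠ 0 := fun x hx =>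
    hreg x ⟨h01.le.trans hx.1.1, hx.1.2.trans h23.le⟩ fun h => hx.2 (h ▸ hpW)
  have hξ₀f : ∀ x ∈ (U₂ ∪ Uφ) ∩ C, mlineDeriv (𝓡∂ (n + 1)) f x (ξ₀ x) = 1 := by
    rintro x ⟨hx | hx, hxC⟩
    · rw [hξ₀U₂ x hx]; exact hξ₂f x hx
    · rw [hξ₀φ x hx]
      refine D₀.mlineDeriv_eq_one hx.1 ?_
      rw [hD₀coord]
      by_contra hlt
      refine hxC.2 ⟨hx.1, ?_⟩
      show Φ x ∈ ball u₀ (2 * r)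
      rw [mem_ball, dist_eq_norm]
      exact not_le.1 hlt
  -- the global field with prescribed germ and unit speed
  obtain ⟨ξ₁, hξ₁K, hξ₁C⟩ := exists_contMDiffSection_eq_on_and_mlineDeriv_eq_one_on hf
    (hK₂.union hKφc.isClosed) hCc (hU₂.union hUφo) (union_subset_union hKU₂ hKφ_sub)
    hξ₀_smooth hξ₀f hregC
  -- the cut-off
  set χ : ℝ → ℝ := plateauCutoff ℓ₀ ℓ₁ ℓ₂ ℓ₃ with hχ
  set X : Π x : M, TangentSpace (𝓡∂ (n + 1)) x := fun x => χ (f x) • ξ₁ x with hX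
  have hXs : ContMDiff (𝓡∂ (n + 1)) (𝓡∂ (n + 1)).tangent ∞ (fun x => (⟨x, X x⟩ : TangentBundle (𝓡∂ (n + 1)) M)) :=
    ((contDiff_plateauCutoff _ _ _ _).comp_contMDiff hf).smul_section ξ₁.contMDiff
  have hχ1 : ∀ x, f x ∈ Icc ℓ₁ ℓ₂ → χ (f x) = 1 := fun x hx => plateauCutoff_eq_one h01 h23 hx
  have hX1 : ∀ x, f x ∈ Icc ℓ₁ ℓ₂ → X x = ξ₁ x := fun x hx => by
    simp only [hX, hχ1 x hx, one_smul]
  have hX0 : ∀ x, f x ∉ Ioo ℓ₀ ℓ₃ → X x = 0 := fun x hx => by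
    show χ (f x) • ξ₁ x = 0
    rw [show χ (f x) = 0 from plateauCutoff_eq_zero_of_not_mem h01 h23 hx, zero_smul]
  -- levels of the chart ball
  have hlevel : ∀ x ∈ φ.source, ‖Φ x - u₀‖ < R₁ → f x ∈ Icc ℓ₁ ℓ₂ := by
    intro x hx hxR
    have hq := hfq x hx
    have hQ : |milnorQuadratic k (Φ x - u₀)| ≤ ‖Φ x - u₀‖ ^ 2 := by
      rw [milnorQuadratic_eq, abs_le]
      have hA := sqSumLT_nonneg (m := n + 1) k (Φ x - u₀)
      have hB := sqSumGE_nonneg (m := n + 1) k (Φ x - u₀)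
      have hAB := sqSumLT_add_sqSumGE (m := n + 1) k (Φ x - u₀)
      constructor <;> nlinarith
    have hsq : ‖Φ x - u₀‖ ^ 2 < R₁ ^ 2 := by
      have := norm_nonneg (Φ x - u₀); nlinarith
    rw [abs_le] at hQ
    constructor <;> [skip; skip] <;> rw [hq] <;> nlinarith [hQ.1, hQ.2]
  -- `X` on the chart ball of radius `R₁`
  have hXO : ∀ x ∈ O, X x = handlePullback (J := 𝓡∂ (n + 1)) φ p k hr x := by
    rintro x ⟨hx, hxb⟩
    have hxb' : ‖Φ x - u₀‖ < R₁ := by simpa [dist_eq_norm] using hxb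
    rw [hX1 x (hlevel x hx hxb'), hξ₁K x (Or.inr (hO_sub ⟨hx, hxb⟩)), hξ₀φ x ⟨hx, ?_⟩]
    exact ball_subset_ball hR₁R.le hxb
  -- the handle chart of `X`: restrict `φ` to `O`
  have hO' : IsOpen (Φ ⁻¹' ball u₀ R₁ ∩ φ.source) := by rw [inter_comm]; exact hOo
  set φ' := φ.restr O with hφ'
  have hφ'm : φ' ∈ IsManifold.maximalAtlas (𝓡∂ (n + 1)) ∞ M := restr_mem_maximalAtlas _ hφ hOo
  have hφ's : φ'.source = O := by
    rw [hφ', OpenPartialHomeomorph.restr_source, hOo.interior_eq, inter_eq_right]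
    exact inter_subset_left
  have hφ'e : ∀ q, φ'.extend (𝓡∂ (n + 1)) q = Φ q := fun q => rfl
  have hpO : p ∈ O := ⟨hpφ, by simp [hu₀, hR₁]⟩
  let D : HandleChart (𝓡∂ (n + 1)) f X p := HandleChart.ofEqOn φ' hφ'm (by rw [hφ's]; exact hpO) k hr
    (fun q hq => by rw [hφ's] at hq; rw [hφ'e, hφ'e]; exact hfq q hq.1)
    (fun q hq => by rw [hφ's] at hq; exact hXO q hq)
  refine ⟨X, D, ⟨hXs, fun x => ?_⟩, rfl, rfl, hφ'e, hφ's, fun x hx => ?_, fun x hx hxW => ?_, hX0,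
    fun x hx hxs hxR => hXO x ⟨hxs, by simpa [dist_eq_norm] using hxR⟩⟩
  · -- interior field
    refine ((𝓡∂ (n + 1)).isInteriorPoint_or_isBoundaryPoint x).imp_right fun hb => ?_
    have h3 : ℓ₃ < f x := hbd x hb
    have hev : ∀ᶠ y in 𝓝 x, ℓ₃ < f y := hf.continuous.continuousAt.eventually_const_lt h3
    filter_upwards [hev] with y hy
    exact hX0 y fun h => absurd h.2 (not_lt.2 hy.le)
  · -- `X = ξ₂` on `K₂`
    rw [hX1 x (hK₂ℓ x hx), hξ₁K x (Or.inl hx), hξ₀U₂ x (hKU₂ hx)]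
  · -- unit speed off the core
    rw [hX1 x hx]
    exact hξ₁C x ⟨hx, hxW⟩

end Literature.Topology.FourManifolds
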